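import Mathlib.Analysis.Normed.Operator.Bilinear
import Mathlib.Analysis.Calculus.FDeriv.Bilinear
import Mathlib.Analysis.Calculus.ContDiff.Operations
import Literature.Barriers.QuantumFields.NoClassicalGlueballsStressTensor
import HarnessLib

/-!
# No classical glueballs: the real trace form on `M_n(ℂ)` (the invariant form for `𝔲(n)`)

Sibling of `Literature/Barriers/QuantumFields/NoClassicalGlueballs.lean` and
`NoClassicalGlueballsStressTensor.lean` (barrier catalogue D-0021, summit `QuantumFields`). The
latter sets up the Yang–Mills stress tensor `stressTensor B A` for an abstract invariant positive
form `B` on the coefficient algebra (`IsInvariantForm 𝔤 B`). This file provides the concrete form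
for the compact gauge algebras of `NoClassicalGlueballs` — `𝔲(n) = skewAdjoint.submodule ℝ M_n(ℂ)`
and `𝔰𝔲(N) = suAlgebra N` inside `M_n(ℂ)` with the (scoped) Frobenius norm:

* `traceForm X Y = Re tr (Xᴴ Y) = Σ_{ij} (Re X_{ij} Re Y_{ij} + Im X_{ij} Im Y_{ij})`, the real inner
  product whose norm is the Frobenius norm (`traceForm_self : ⟨X, X⟩ = ‖X‖²`; Mathlib has the
  complex Frobenius inner product as the non-instance `Matrix.toMatrixInnerProductSpace`, of which
  this is the real part; it is not installed here for the reason in the design note below);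
  symmetric, bilinear (`traceFormₗ`), Cauchy–Schwarz (`abs_traceForm_le`), continuous
  (`traceFormL`, via `LinearMap.mkContinuous₂`), with the product rule `fderiv_traceForm_apply`;
* `traceForm_lie_left`: `⟨[B, X], Y⟩ = −⟨X, [B, Y]⟩` for skew-Hermitian `B` (cyclicity of the
  trace) — the `ad`-invariance behind "the twelve cubic terms, each of which is a scalar triple
  product, all cancel" in the energy identity [GlasseyStrauss1979, §3];
* `isInvariantForm_traceFormL : IsInvariantForm (skewAdjoint.submodule ℝ M_n(ℂ)) traceFormL` and
  `isInvariantForm_traceFormL_suAlgebra : IsInvariantForm (suAlgebra N) traceFormL`, so that all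
  results of `NoClassicalGlueballsStressTensor` apply to `𝔲(n)`- and `𝔰𝔲(N)`-valued connections
  with `B = traceFormL` (`θ₀₀ = ymEnergyDensity`, conservation, …).

Design note. Mathlib equips `Matrix m n α` with a *global* product-topology instance
(`instTopologicalSpaceMatrix`) but with the Frobenius normed structure only as a scoped instance
(`open scoped Matrix.Norms.Frobenius`, as in `NoClassicalGlueballs`). The two topologies agree
definitionally but not reducibly, so a continuous-linear-map type written literally as
`Matrix n n ℂ →L[ℝ] _` picks the global instance and then fails to match the maps produced by
`fderiv`. The continuous bilinear map `traceFormL` is therefore built by `LinearMap.mkContinuous₂`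
with its type inferred, never spelled out.

## References

* R. T. Glassey, W. A. Strauss, *Decay of classical Yang–Mills fields*, Commun. Math. Phys. 65
  (1979) 1–13, §3 [GlasseyStrauss1979].
* S. Coleman, *There are no classical glueballs*, Commun. Math. Phys. 55 (1977) 113–116, §2 (1)–(3)
  ("the c's are the structure constants of a compact Lie group") [Coleman1977].
* R. A. Horn, C. R. Johnson, *Matrix Analysis* (2nd ed.), (0.2.5), §5.6 (Frobenius inner product)
  [HornJohnson2013].
-/

noncomputable section

open scoped ContDiff Matrix Matrix.Norms.Frobenius ComplexConjugate

namespace Literature.Barriers.QuantumFields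

open Literature.MathematicalPhysics.QuantumLattice Literature.MathematicalPhysics.QuantumFieldTheory

section TraceForm

variable {n : Type*} [Fintype n]

/-- The **real trace form** `⟨X, Y⟩ = Re tr (Xᴴ Y)` on `M_n(ℂ)`: the real inner product whose
norm is the Frobenius norm, `⟨X, X⟩ = Σ_{ij} |X_{ij}|²` (the real part of Mathlib's complex
Frobenius inner product `Matrix.toMatrixInnerProductSpace`); restricted to `𝔲(n)` it is
`−Re tr (XY)`, the `Ad`-invariant form in which `e = ½(|E|² + |H|²)` is written. [folklore] -/
def traceForm (X Y : Matrix n n ℂ) : ℝ :=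
  (Matrix.trace (Xᴴ * Y)).re

/-- Entrywise formula: `⟨X, Y⟩ = Σ_{ij} (Re X_{ij} Re Y_{ij} + Im X_{ij} Im Y_{ij})`. [folklore] -/
theorem traceForm_eq_sum (X Y : Matrix n n ℂ) :
    traceForm X Y = ∑ i, ∑ j, ((X i j).re * (Y i j).re + (X i j).im * (Y i j).im) := by
  unfold traceForm Matrix.trace
  simp only [Matrix.diag, Matrix.mul_apply, Matrix.conjTranspose_apply, Complex.re_sum,
    Complex.mul_re, Complex.star_def, Complex.conj_re, Complex.conj_im]
  rw [Finset.sum_comm]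
  refine Finset.sum_congr rfl fun i _ => Finset.sum_congr rfl fun j _ => ?_
  ring

/-- The trace form is symmetric. [folklore] -/
theorem traceForm_comm (X Y : Matrix n n ℂ) : traceForm X Y = traceForm Y X := by
  rw [traceForm_eq_sum, traceForm_eq_sum]
  refine Finset.sum_congr rfl fun i _ => Finset.sum_congr rfl fun j _ => ?_
  ring

/-- Additivity in the first argument. [folklore] -/
theorem traceForm_add_left (X X' Y : Matrix n n ℂ) :
    traceForm (X + X') Y = traceForm X Y + traceForm X' Y := by
  simp only [traceForm_eq_sum, Matrix.add_apply, Complex.add_re, Complex.add_im,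
    ← Finset.sum_add_distrib]
  refine Finset.sum_congr rfl fun i _ => Finset.sum_congr rfl fun j _ => ?_
  ring

/-- Homogeneity in the first argument. [folklore] -/
theorem traceForm_smul_left (c : ℝ) (X Y : Matrix n n ℂ) :
    traceForm (c • X) Y = c * traceForm X Y := by
  simp only [traceForm_eq_sum, Matrix.smul_apply, Complex.real_smul, Complex.re_ofReal_mul,
    Complex.im_ofReal_mul, Finset.mul_sum]
  refine Finset.sum_congr rfl fun i _ => Finset.sum_congr rfl fun j _ => ?_
  ring

/-- Additivity in the second argument. [folklore] -/
theorem traceForm_add_right (X Y Y' : Matrix n n ℂ) :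
    traceForm X (Y + Y') = traceForm X Y + traceForm X Y' := by
  rw [traceForm_comm, traceForm_add_left, traceForm_comm Y, traceForm_comm Y']

/-- Homogeneity in the second argument. [folklore] -/
theorem traceForm_smul_right (c : ℝ) (X Y : Matrix n n ℂ) :
    traceForm X (c • Y) = c * traceForm X Y := by
  rw [traceForm_comm, traceForm_smul_left, traceForm_comm]

/-- `⟨−X, Y⟩ = −⟨X, Y⟩`. [folklore] -/
theorem traceForm_neg_left (X Y : Matrix n n ℂ) : traceForm (-X) Y = -traceForm X Y := by
  simpa using traceForm_smul_left (-1) X Y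

/-- `⟨X, −Y⟩ = −⟨X, Y⟩`. [folklore] -/
theorem traceForm_neg_right (X Y : Matrix n n ℂ) : traceForm X (-Y) = -traceForm X Y := by
  simpa using traceForm_smul_right (-1) X Y

/-- `⟨X − X', Y⟩ = ⟨X, Y⟩ − ⟨X', Y⟩`. [folklore] -/
theorem traceForm_sub_left (X X' Y : Matrix n n ℂ) :
    traceForm (X - X') Y = traceForm X Y - traceForm X' Y := by
  rw [sub_eq_add_neg, traceForm_add_left, traceForm_neg_left, ← sub_eq_add_neg]

/-- `⟨X, Y − Y'⟩ = ⟨X, Y⟩ − ⟨X, Y'⟩`. [folklore] -/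
theorem traceForm_sub_right (X Y Y' : Matrix n n ℂ) :
    traceForm X (Y - Y') = traceForm X Y - traceForm X Y' := by
  rw [sub_eq_add_neg, traceForm_add_right, traceForm_neg_right, ← sub_eq_add_neg]

/-- `⟨0, Y⟩ = 0`. [folklore] -/
@[simp]
theorem traceForm_zero_left (Y : Matrix n n ℂ) : traceForm 0 Y = 0 := by
  simp [traceForm]

/-- `⟨X, 0⟩ = 0`. [folklore] -/
@[simp]
theorem traceForm_zero_right (X : Matrix n n ℂ) : traceForm X 0 = 0 := by
  simp [traceForm]

/-- Finite sums in the first argument. [folklore] -/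
theorem traceForm_sum_left {ι : Type*} (s : Finset ι) (X : ι → Matrix n n ℂ) (Y : Matrix n n ℂ) :
    traceForm (∑ i ∈ s, X i) Y = ∑ i ∈ s, traceForm (X i) Y := by
  classical
  induction s using Finset.induction_on with
  | empty => simp
  | insert a s ha ih => rw [Finset.sum_insert ha, Finset.sum_insert ha, traceForm_add_left, ih]

/-- Finite sums in the second argument. [folklore] -/
theorem traceForm_sum_right {ι : Type*} (s : Finset ι) (X : Matrix n n ℂ) (Y : ι → Matrix n n ℂ) :
    traceForm X (∑ i ∈ s, Y i) = ∑ i ∈ s, traceForm X (Y i) := by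
  rw [traceForm_comm, traceForm_sum_left]
  exact Finset.sum_congr rfl fun i _ => traceForm_comm _ _

/-- **The trace form is the inner product of the Frobenius norm**: `⟨X, X⟩ = ‖X‖²`
(Horn–Johnson (0.2.5): `‖A‖₂² = tr A*A`; tree lemma `Matrix.frobenius_norm_sq_eq_re_trace`). [folklore] -/
theorem traceForm_self (X : Matrix n n ℂ) : traceForm X X = ‖X‖ ^ 2 := by
  rw [Matrix.frobenius_norm_sq_eq_re_trace]
  simp [traceForm]

/-- `⟨X, X⟩ ≥ 0`. [folklore] -/
theorem traceForm_self_nonneg (X : Matrix n n ℂ) : 0 ≤ traceForm X X := by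
  rw [traceForm_self]; positivity

/-- **`ad`-invariance of the trace form under skew-Hermitian matrices**: for `Bᴴ = −B`,
`⟨[B, X], Y⟩ = −⟨X, [B, Y]⟩` (cyclicity of the trace). This is the algebra behind the
cancellation of the cubic ("scalar triple product") terms in the Yang–Mills energy and momentum
identities. [cite: GlasseyStrauss1979, §3 (derivation of (e))] -/
theorem traceForm_lie_left {B : Matrix n n ℂ} (hB : Bᴴ = -B) (X Y : Matrix n n ℂ) :
    traceForm ⁅B, X⁆ Y = -traceForm X ⁅B, Y⁆ := by
  simp only [traceForm, Ring.lie_def, Matrix.conjTranspose_sub, Matrix.conjTranspose_mul, hB,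
    Matrix.sub_mul, Matrix.mul_sub, Matrix.trace_sub, Complex.sub_re, Matrix.neg_mul,
    Matrix.mul_neg, Matrix.trace_neg, Complex.neg_re]
  rw [Matrix.mul_assoc, Matrix.mul_assoc, Matrix.trace_mul_comm B (Xᴴ * Y), Matrix.mul_assoc]
  ring

/-- For skew-Hermitian `B`: `⟨X, [B, X]⟩ = 0`. [folklore] -/
theorem traceForm_lie_self {B : Matrix n n ℂ} (hB : Bᴴ = -B) (X : Matrix n n ℂ) :
    traceForm X ⁅B, X⁆ = 0 := by
  have h := traceForm_lie_left hB X X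
  rw [traceForm_comm ⁅B, X⁆ X] at h
  linarith

omit [Fintype n] in
/-- Elements of Mathlib's `skewAdjoint.submodule ℝ M_n(ℂ)` (`= 𝔲(n)`) are the skew-Hermitian
matrices. [folklore] -/
theorem conjTranspose_eq_neg_of_mem_skewAdjoint {B : Matrix n n ℂ}
    (hB : B ∈ skewAdjoint.submodule ℝ (Matrix n n ℂ)) : Bᴴ = -B := by
  simpa [skewAdjoint.submodule, skewAdjoint.mem_iff, Matrix.star_eq_conjTranspose] using hB

/-- **Cauchy–Schwarz for the trace form**: `⟨X, Y⟩ ≤ ‖X‖ ‖Y‖` (Frobenius norms). [folklore] -/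
theorem traceForm_le_norm_mul_norm (X Y : Matrix n n ℂ) : traceForm X Y ≤ ‖X‖ * ‖Y‖ := by
  by_cases hX : X = 0
  · simp [hX]
  by_cases hY : Y = 0
  · simp [hY]
  have hp : 0 < ‖X‖ * ‖Y‖ := mul_pos (norm_pos_iff.2 hX) (norm_pos_iff.2 hY)
  have h := traceForm_self_nonneg (‖Y‖ • X - ‖X‖ • Y)
  simp only [traceForm_sub_left, traceForm_sub_right, traceForm_smul_left,
    traceForm_smul_right] at h
  simp only [traceForm_self, traceForm_comm Y X] at h
  nlinarith [h, hp, norm_nonneg X, norm_nonneg Y]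

/-- `|⟨X, Y⟩| ≤ ‖X‖ ‖Y‖`. [folklore] -/
theorem abs_traceForm_le (X Y : Matrix n n ℂ) : |traceForm X Y| ≤ ‖X‖ * ‖Y‖ := by
  refine abs_le.2 ⟨?_, traceForm_le_norm_mul_norm X Y⟩
  have h := traceForm_le_norm_mul_norm (-X) Y
  rw [traceForm_neg_left, norm_neg] at h
  linarith

/-- The trace form as an `ℝ`-bilinear map. [folklore] -/
def traceFormₗ : Matrix n n ℂ →ₗ[ℝ] Matrix n n ℂ →ₗ[ℝ] ℝ :=
  LinearMap.mk₂ ℝ (traceForm (n := n)) traceForm_add_left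
    (fun c X Y => by rw [traceForm_smul_left, smul_eq_mul]) traceForm_add_right
    (fun c X Y => by rw [traceForm_smul_right, smul_eq_mul])

/-- `traceFormₗ X Y = ⟨X, Y⟩`. [folklore] -/
@[simp]
theorem traceFormₗ_apply (X Y : Matrix n n ℂ) : traceFormₗ X Y = traceForm X Y := rfl

/-- The trace form as a continuous bilinear map `M_n(ℂ) →L[ℝ] M_n(ℂ) →L[ℝ] ℝ` of norm `≤ 1` for the
Frobenius norm (the type is inferred from `LinearMap.mkContinuous₂`, so that the topology on
`M_n(ℂ)` is the one of the scoped Frobenius normed structure and not Mathlib's global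
product-topology instance on matrices). [folklore] -/
def traceFormL :=
  LinearMap.mkContinuous₂ (traceFormₗ (n := n)) 1 fun X Y => by
    rw [one_mul, traceFormₗ_apply, Real.norm_eq_abs]
    exact abs_traceForm_le X Y

/-- `traceFormL X Y = ⟨X, Y⟩`. [folklore] -/
@[simp]
theorem traceFormL_apply (X Y : Matrix n n ℂ) : traceFormL X Y = traceForm X Y := rfl

variable {E' : Type*} [NormedAddCommGroup E'] [NormedSpace ℝ E']

/-- **Product rule for the trace form**: `∂_v ⟨f, g⟩ = ⟨∂_v f, g⟩ + ⟨f, ∂_v g⟩`. [folklore] -/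
theorem fderiv_traceForm_apply {f g : E' → Matrix n n ℂ} {x : E'} (hf : DifferentiableAt ℝ f x)
    (hg : DifferentiableAt ℝ g x) (v : E') :
    fderiv ℝ (fun y => traceForm (f y) (g y)) x v =
      traceForm (fderiv ℝ f x v) (g x) + traceForm (f x) (fderiv ℝ g x v) := by
  have h : HasFDerivAt (fun y => traceForm (f y) (g y))
      ((traceFormL (n := n)).precompR E' (f x) (fderiv ℝ g x) +
        (traceFormL (n := n)).precompL E' (fderiv ℝ f x) (g x)) x :=
    (traceFormL (n := n)).hasFDerivAt_of_bilinear hf.hasFDerivAt hg.hasFDerivAt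
  rw [h.fderiv]
  change traceForm (f x) (fderiv ℝ g x v) + traceForm (fderiv ℝ f x v) (g x) = _
  exact add_comm _ _

/-- `y ↦ ⟨f y, g y⟩` is differentiable where `f` and `g` are. [folklore] -/
theorem DifferentiableAt.traceForm {f g : E' → Matrix n n ℂ} {x : E'}
    (hf : DifferentiableAt ℝ f x) (hg : DifferentiableAt ℝ g x) :
    DifferentiableAt ℝ (fun y => traceForm (f y) (g y)) x :=
  ((traceFormL (n := n)).hasFDerivAt_of_bilinear hf.hasFDerivAt hg.hasFDerivAt).differentiableAt

/-- `y ↦ ⟨f y, g y⟩` is `C^m` when `f` and `g` are. [folklore] -/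
theorem ContDiff.traceForm {m : WithTop ℕ∞} {f g : E' → Matrix n n ℂ} (hf : ContDiff ℝ m f)
    (hg : ContDiff ℝ m g) : ContDiff ℝ m fun y => traceForm (f y) (g y) := by
  have h1 : ContDiff ℝ m fun y => traceFormL (n := n) (f y) := (traceFormL (n := n)).contDiff.comp hf
  exact h1.clm_apply hg

end TraceForm

/-! ### The trace form is an invariant positive form for `𝔲(n)` and `𝔰𝔲(N)` -/

section Invariant

/-- An invariant form for `𝔤` is one for every smaller gauge algebra `𝔤' ≤ 𝔤`. [folklore] -/
theorem IsInvariantForm.mono {𝔸 : Type*} [NormedRing 𝔸] [NormedAlgebra ℝ 𝔸]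
    {𝔤 𝔤' : Submodule ℝ 𝔸} {B : 𝔸 →L[ℝ] 𝔸 →L[ℝ] ℝ} (h : IsInvariantForm 𝔤 B) (h' : 𝔤' ≤ 𝔤) :
    IsInvariantForm 𝔤' B where
  symm := h.symm
  apply_self := h.apply_self
  lie_apply_add a ha := h.lie_apply_add a (h' ha)

variable {n : Type*} [Fintype n] [DecidableEq n]

/-- **The trace form is an invariant positive form for `𝔲(n)`** (`= skewAdjoint.submodule ℝ M_n(ℂ)`,
Frobenius norm): symmetric, `⟨X, X⟩ = ‖X‖²`, and `⟨[a, X], Y⟩ + ⟨X, [a, Y]⟩ = 0` for skew-Hermitian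
`a`. [cite: Coleman1977, §2 (1)–(3)] -/
theorem isInvariantForm_traceFormL :
    IsInvariantForm (𝔸 := Matrix n n ℂ) (skewAdjoint.submodule ℝ (Matrix n n ℂ)) traceFormL where
  symm X Y := traceForm_comm X Y
  apply_self X := traceForm_self X
  lie_apply_add a ha X Y := by
    have hB := conjTranspose_eq_neg_of_mem_skewAdjoint ha
    show traceForm ⁅a, X⁆ Y + traceForm X ⁅a, Y⁆ = 0
    rw [traceForm_lie_left hB]
    ring

/-- The trace form is an invariant positive form for `𝔰𝔲(N) = suAlgebra N ≤ 𝔲(N)`.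
[cite: GlasseyStrauss1979, §2 ("we choose the gauge group to be SU(2)")] -/
theorem isInvariantForm_traceFormL_suAlgebra (N : ℕ) :
    IsInvariantForm (𝔸 := Matrix (Fin N) (Fin N) ℂ) (suAlgebra N) traceFormL :=
  isInvariantForm_traceFormL.mono inf_le_left

end Invariant

end Literature.Barriers.QuantumFields
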